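/-
Copyright (c) 2026. All rights reserved.
Released under Apache 2.0 license as described in the file LICENSE.
-/
import Literature.Geometry.Kaehler.ComplexTorusQuaternionAxisEllipticPoints
import HarnessLib

/-!
# The CM members of Lang's `(−1,3)` family over the axis of `2 + j` are SQUARES: `A(iy) ≅ (ℂ/(ℤ + ℤi√t))²`,
# `t = m² − 3n²` the norm of the primitive special vector `m·i + n·ij` fixing `iy`
# (Shioda–Mitani 1974 §3–§4; Kudla–Rapoport–Yang 2006 §3.4; Lang 1982 IX §5)

[tag: complex_torus] [tag: abelian_surface] [tag: quaternion_multiplication] [tag: complex_multiplication]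
[tag: shimura_curve] [tag: special_cycles] [tag: binary_quadratic_form] [tag: elliptic_curve]

Lane `lit-hodgefound`, seat p12, row g28-#6 — THEOREMS ONLY (no definition, no named fact, no instance); the sequel of
g28-#4/#5 (`…QuaternionImaginaryAxis`: the CM criterion `m(1 − y²) = n√3(1 + y²)` on the axis `iℝ_{>0}`;
`…QuaternionAxisEllipticPoints`: its elliptic points). Off the axis a CM member may be a product of two NON-isomorphic
curves (g28-#3: `A(τ₃) ≅ ℂ/ℤ[ω] × ℂ/ℤ[√−3]`); ON the axis this never happens: the special vector fixing `iy` is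
`x = m·i + n·ij` (no `j`-component), its Bézout data are `(g, q₀, q₂, u, v) = (1, m, n, u, v)` and Shioda–Mitani's form of
the transcendental lattice (g28-#1) is `(A, B, C) = (t, 0, 1)`, `t = Q(x) = m² − 3n²` — the DIAGONAL form `tX² + Y²` —
so that `A(iy) ≅ A_{(2t,0;0,2)} = C_{i/√t} × C_{i√t} ≅ (ℂ/(ℤ + ℤi√t))²`, the square of the elliptic curve with complex
multiplication by `ℤ[√−t]`. Every CM point of the axis is of this kind (`t` a norm `m² − 3n² > 0` from `ℤ[√3]`,
`gcd(m, n) = 1`); the elliptic points of g28-#5 are the case `t = 1` (`A ≅ C_i × C_i`).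

## The print, VERBATIM

* T. Shioda, N. Mitani (1974) [ShiodaMitani1974] §3 (3.3)–(3.5) «`A_Q = C_{τ₁} × C_{τ₂}`, `τ₁ = (−b + √Δ)/2a`,
  `τ₂ = (b + √Δ)/2`»; Thm. 3.2; §4 Thm. 4.1 (iii), (4.6).
* S. Kudla, M. Rapoport, T. Yang (2006) [KudlaRapoportYang2006] Ch. 1 p. 9 «`Z(t)` … those fake elliptic curves which
  admit complex multiplication by the order `ℤ[√−t]`»; §3.4 Prop. 3.4.1 «The quadratic form `Q` is positive-definite»,
  (3.4.2) «`−x² = Q(x)·id_A`», (3.4.7)–(3.4.9) («The point `z` is fixed by `x̃` … `D_t = ∐_{x ∈ L(t)} D_x`»).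
* S. Lang (1982) [Lang1982AbelianFunctions] Ch. IX §4 (the example `(−1,3)_ℚ`), §5 (1)–(3), Thm. 5.1.

## What is proved (vocabulary of g26–g28: `x(p) = ofStarCoords (−1) 3 p`, `η_τ = eta`, `A(τ) = period (−1) 3 _ _ hτ`,
`w(A(τ), ι) = Nat.card (equivariantEndRingInt …)ˣ`)

* §1 **`t = m² − 3n² > 0`** for a pair `(m, n) ≠ 0` with `m(1 − y²) = n√3(1 + y²)`, `y > 0`
  (`sq_sub_three_mul_sq_pos_of_axis`); every rational such pair comes from a coprime integral one
  (`exists_isCoprime_of_axis`).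
* §2 the special vector `x(p)`, `p = (m, 0, n)`: `x(p) = −(m·i + n·ij)/12`, it fixes `iy`
  (`moebius_rho_ofStarCoords_of_axis`) and commutes with `η_{iy}` (`comm_eta_ofStarCoords_of_axis`); `p` is primitive for
  coprime `(m, n)`.
* §3 **HEADLINE `exists_isIsomorphic_prod_sqrt_of_axis`: for `y > 0` and coprime `(m, n)` with `m(1 − y²) = n√3(1 + y²)`,
  `t = m² − 3n² > 0` and `A(iy) ≅ ℂ/(ℤ + ℤi√t) × ℂ/(ℤ + ℤi√t)`** (`≅ (ℂ/(ℤ + ℤi√t))²`, `isIsomorphic_powPeriod_sqrt_of_axis`);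
  `ρ(A(iy)) = 4` (`finrank_neronSeveriGroup_eq_four_of_axis`); `w(A(iy), ι) = 2` when `t ≠ 1` (`natCard_units_eq_two_of_axis`).
* §4 **EVERY CM member over the axis is such a square**: `A(iy)` is not simple iff `A(iy) ≅ (ℂ/(ℤ + ℤi√t))²` for some
  coprime `(m, n)` with `t = m² − 3n² > 0` (`not_isSimple_axis_iff_exists_sq`).
* §5 the `Z(6)`-point `i√(2 − √3)` (`= i(√6 − √2)/2`; `(m, n) = (3, 1)`): **`A(i√(2−√3)) ≅ (ℂ/(ℤ + ℤi√6))²`**,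
  `ρ = 4`, `w = 2` (`isIsomorphic_sqrt_two_sub_sqrt_three_prod`).

## Honest scope

Only the axis of `2 + j` of Lang's example (`𝔬 = ℤ⟨1,i,j,ij⟩`, the tree's `ρ`); CM points off the axis (g28-#3) are not
squares in general. Which `t` occur (the positive norms `m² − 3n²` of primitive elements of `ℤ[√3]`) is not described
further. 0 definitions, 0 named facts, 0 instances — net debt `0`.

## References
* [ShiodaMitani1974] T. Shioda, N. Mitani, *Singular abelian surfaces and binary quadratic forms*, LNM 412 (1974), §3
  (3.3)–(3.5), Thm. 3.2; §4 Thm. 4.1, (4.6).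
* [KudlaRapoportYang2006] S. Kudla, M. Rapoport, T. Yang, *Modular Forms and Special Cycles on Shimura Curves* (2006),
  Ch. 1 p. 9; §3.4 Prop. 3.4.1, (3.4.2), (3.4.7)–(3.4.9).
* [Lang1982AbelianFunctions] S. Lang, *Introduction to Algebraic and Abelian Functions* (1982), Ch. IX §4–§5.
-/

noncomputable section

set_option maxSynthPendingDepth 3

open Complex Module Matrix Quaternion Function
open scoped ComplexConjugate MatrixGroups

namespace Literature.Geometry.Kaehler.ComplexTorus.QuaternionType

/-! ## §0 Arithmetic helpers -/

section Helpers

/-- `√3 · √3 = 3`. [folklore] -/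
private theorem sqrt_three_mul_self'' : Real.sqrt 3 * Real.sqrt 3 = 3 := Real.mul_self_sqrt (by norm_num)

/-- `√3 ≠ 0`. [folklore] -/
private theorem sqrt_three_ne_zero' : Real.sqrt 3 ≠ 0 := by
  rw [ne_eq, Real.sqrt_eq_zero (by norm_num)]; norm_num

/-- `√3 < 2`. [folklore] -/
private theorem sqrt_three_lt_two' : Real.sqrt 3 < 2 := by
  rw [show (2 : ℝ) = Real.sqrt 4 by rw [show (4 : ℝ) = 2 ^ 2 by norm_num, Real.sqrt_sq (by norm_num)]]
  exact Real.sqrt_lt_sqrt (by norm_num) (by norm_num)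

/-- `(√t)² = t` in `ℂ` for an integer `t > 0`. [folklore] -/
private theorem sqrt_intCast_sq {t : ℤ} (ht : 0 < t) : ((Real.sqrt t : ℝ) : ℂ) ^ 2 = (t : ℂ) := by
  rw [← Complex.ofReal_pow, Real.sq_sqrt (by exact_mod_cast ht.le)]
  norm_cast

/-- `(−1,3)_ℚ` is a skew field (tree, p35), in the cast form used by the family. [folklore] -/
private theorem forall_isUnit_neg_one_three' :
    ∀ x : ℍ[ℚ,((-1 : ℤ) : ℚ),((3 : ℤ) : ℚ)], x ≠ 0 → IsUnit x := by
  exact_mod_cast Literature.RingTheory.CentralSimple.forall_isUnit_quaternionAlgebra_neg_one_three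

/-- Transport of `X ≅ C_{i√t} × C_{i√t}` along `t = t′`. [folklore] -/
private theorem isIsomorphic_prod_sqrt_congr {ι : Type*} [Fintype ι] [DecidableEq ι] {E : Type*}
    [NormedAddCommGroup E] [NormedSpace ℂ E] {Φ : (ι → ℝ) ≃L[ℝ] E} {t t' : ℤ} (ht : 0 < t) (ht' : 0 < t')
    (h : t = t') (hX : IsIsomorphic Φ (prodPeriod (ellipticPeriod (sqrt_mul_I_im_ne_zero ht))
      (ellipticPeriod (sqrt_mul_I_im_ne_zero ht)))) :
    IsIsomorphic Φ (prodPeriod (ellipticPeriod (sqrt_mul_I_im_ne_zero ht')) (ellipticPeriod (sqrt_mul_I_im_ne_zero ht'))) := by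
  subst h
  exact hX

end Helpers

/-! ## §1 The norm `t = m² − 3n²` is positive; coprime normalisation -/

section Norm

/-- **`t = m² − 3n² > 0`** for a pair `(m, n) ≠ (0, 0)` satisfying the axis relation `m(1 − y²) = n√3(1 + y²)` with
`y > 0`: squaring, `(m² − 3n²)(1 − y²)² = 12n²y²`; so `t > 0` unless `n = 0`, where `t = m² > 0`. (`t = Q(x)` is the
value of KRY's positive-definite form on the special vector `x = m·i + n·ij`.) [cite: KudlaRapoportYang2006, §3.4 Prop. 3.4.1 («The quadratic form `Q` is positive-definite») and (3.4.2)] -/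
theorem sq_sub_three_mul_sq_pos_of_axis {y : ℝ} (hy : 0 < y) {m n : ℝ} (hmn : m ≠ 0 ∨ n ≠ 0)
    (hrel : m * (1 - y ^ 2) = Real.sqrt 3 * n * (1 + y ^ 2)) : 0 < m ^ 2 - 3 * n ^ 2 := by
  have hs := sqrt_three_mul_self''
  have key : (m ^ 2 - 3 * n ^ 2) * (1 - y ^ 2) ^ 2 = 12 * n ^ 2 * y ^ 2 := by
    have h2 : (m * (1 - y ^ 2)) ^ 2 = (Real.sqrt 3 * n * (1 + y ^ 2)) ^ 2 := by rw [hrel]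
    linear_combination h2 + (n ^ 2 * (1 + y ^ 2) ^ 2) * hs
  by_cases hn : n = 0
  · subst hn
    have hm : m ≠ 0 := hmn.resolve_right (fun h ↦ h rfl)
    have : 0 < m ^ 2 := by positivity
    nlinarith [this]
  · have h1 : (1 - y ^ 2) ≠ 0 := by
      intro h0
      apply hn
      have h' : Real.sqrt 3 * n * (1 + y ^ 2) = 0 := by rw [← hrel, h0, mul_zero]
      have h1y : (1 + y ^ 2) ≠ 0 := by positivity
      simpa [sqrt_three_ne_zero', h1y] using h'
    have h12 : 0 < 12 * n ^ 2 * y ^ 2 := by positivity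
    have hsq : 0 < (1 - y ^ 2) ^ 2 := by positivity
    by_contra hle
    rw [not_lt] at hle
    nlinarith [key, h12, hle, hsq, mul_nonpos_of_nonpos_of_nonneg hle hsq.le]

/-- **Coprime normalisation**: a rational pair `(m, n) ≠ 0` with `m(1 − y²) = n√3(1 + y²)` may be replaced by a coprime
integral pair (clear denominators, divide by the gcd) — the PRIMITIVE special vector `m·i + n·ij` of KRY's `L(t)^{prim}`.
[cite: KudlaRapoportYang2006, §3.4 (3.4.8) and Prop. 3.4.5 («`L(c²d)^{prim}`»)] -/
theorem exists_isCoprime_of_axis {y : ℝ} {m n : ℚ} (hmn : m ≠ 0 ∨ n ≠ 0)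
    (hrel : (m : ℝ) * (1 - y ^ 2) = Real.sqrt 3 * n * (1 + y ^ 2)) :
    ∃ M N : ℤ, IsCoprime M N ∧ (M : ℝ) * (1 - y ^ 2) = Real.sqrt 3 * N * (1 + y ^ 2) := by
  -- clear denominators: `M₀ = m·(den m)(den n)`, `N₀ = n·(den m)(den n)`
  set M₀ : ℤ := m.num * n.den with hM₀
  set N₀ : ℤ := n.num * m.den with hN₀
  have hM₀' : (M₀ : ℚ) = m * (m.den * n.den) := by
    rw [hM₀]; push_cast; rw [← Rat.mul_den_eq_num m]; ring
  have hN₀' : (N₀ : ℚ) = n * (m.den * n.den) := by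
    rw [hN₀]; push_cast; rw [← Rat.mul_den_eq_num n]; ring
  have hM₀R : (M₀ : ℝ) = (m : ℝ) * ((m.den : ℝ) * n.den) := by exact_mod_cast congrArg (Rat.cast : ℚ → ℝ) hM₀'
  have hN₀R : (N₀ : ℝ) = (n : ℝ) * ((m.den : ℝ) * n.den) := by exact_mod_cast congrArg (Rat.cast : ℚ → ℝ) hN₀'
  have h0 : M₀ ≠ 0 ∨ N₀ ≠ 0 := by
    rcases hmn with h | h
    · exact Or.inl (mul_ne_zero (Rat.num_ne_zero.2 h) (by exact_mod_cast n.den_nz))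
    · exact Or.inr (mul_ne_zero (Rat.num_ne_zero.2 h) (by exact_mod_cast m.den_nz))
  have hrel₀ : (M₀ : ℝ) * (1 - y ^ 2) = Real.sqrt 3 * N₀ * (1 + y ^ 2) := by
    rw [hM₀R, hN₀R]
    linear_combination ((m.den : ℝ) * n.den) * hrel
  -- divide by the gcd
  obtain ⟨g, M, N, hg, hMN, hM, hN⟩ := Int.exists_gcd_one' (Int.gcd_pos_iff.2 h0)
  refine ⟨M, N, Int.isCoprime_iff_gcd_eq_one.2 hMN, ?_⟩
  have hg' : (0 : ℝ) < g := by exact_mod_cast hg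
  rw [hM, hN] at hrel₀
  push_cast at hrel₀
  have : ((M : ℝ) * (1 - y ^ 2) - Real.sqrt 3 * N * (1 + y ^ 2)) * g = 0 := by linear_combination hrel₀
  rcases mul_eq_zero.1 this with h | h
  · linear_combination h
  · exact absurd h hg'.ne'

end Norm

/-! ## §2 The special vector `x(p)`, `p = (m, 0, n)`, of a point of the axis -/

section SpecialVector

variable {m n : ℤ}

/-- `x(p) = −(m·i + n·ij)/12` for `p = (m, 0, n)` (`x(p) = (p₁i + p₂j + p₃ij)/4ab`, `4ab = −12`). [cite: KudlaRapoportYang2006, §3.4 (3.4.7)–(3.4.8)] -/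
theorem castQ_ofStarCoords_axis (m n : ℤ) :
    castQ (-1) 3 (ofStarCoords (-1) 3 ![m, 0, n]) =
      (-1 / 12 : ℝ) • castQ (-1) 3 (⟨0, m, 0, n⟩ : ℍ[ℚ,((-1 : ℤ) : ℚ),((3 : ℤ) : ℚ)]) := by
  apply QuaternionAlgebra.ext
  · simp [castQ]
  · simp [castQ]
    ring
  · simp [castQ]
  · simp [castQ, Matrix.cons_val_two]
    ring

/-- **`x(p)` fixes `iy`** when `m(1 − y²) = n√3(1 + y²)`, `(m, n) ≠ 0` (g28-#4's fixed-point equation on the axis for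
`λ = m·i + n·ij`, and `x(p) = −λ/12` has the same Möbius transformation). [cite: KudlaRapoportYang2006, §3.4 (3.4.7)–(3.4.9) («The point `z` is fixed by `x̃`»)] [cite: Lang1982AbelianFunctions, Ch. IX §5 («`GL₂(ℝ)` operates on complex numbers»)] -/
theorem moebius_rho_ofStarCoords_of_axis {y : ℝ} (hy : 0 < y) (hmn : m ≠ 0 ∨ n ≠ 0)
    (hrel : (m : ℝ) * (1 - y ^ 2) = Real.sqrt 3 * n * (1 + y ^ 2)) :
    moebius (rho (-1) 3 (by norm_num) (castQ (-1) 3 (ofStarCoords (-1) 3 ![m, 0, n]))) ((y : ℂ) * I) = (y : ℂ) * I := by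
  rw [castQ_ofStarCoords_axis, map_smul, moebius_smul_of_ne_zero (by norm_num)]
  refine (moebius_rho_eq_self_iff_of_re_eq_zero (ofReal_mul_I_im_ne_zero hy.ne') (by simp) _).2 ⟨?_, rfl, ?_⟩
  · intro h0
    have h1 : (m : ℚ) = 0 := congrArg QuaternionAlgebra.imI h0
    have h3 : (n : ℚ) = 0 := congrArg QuaternionAlgebra.imK h0
    rcases hmn with h | h
    · exact h (by exact_mod_cast h1)
    · exact h (by exact_mod_cast h3)
  · simpa using hrel

/-- **`x(p)η_{iy} = η_{iy}x(p)`**: the special vector commutes with Lang's complex structure at `iy` (g27-#1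
`comm_eta_iff_moebius_eq`; `nr x(p) = t/144 ≠ 0`) — `iy` is a CM point with special vector `m·i + n·ij`.
[cite: KudlaRapoportYang2006, §3.4 (3.4.7) («the action of `x` on `Lie A` … commutes with the action of `O_B`»)] [cite: Lang1982AbelianFunctions, Ch. IX §5 (1)–(2)] -/
theorem comm_eta_ofStarCoords_of_axis {y : ℝ} (hy : 0 < y) (hmn : m ≠ 0 ∨ n ≠ 0)
    (hrel : (m : ℝ) * (1 - y ^ 2) = Real.sqrt 3 * n * (1 + y ^ 2)) :
    castQ (-1) 3 (ofStarCoords (-1) 3 ![m, 0, n]) * eta (-1) 3 (by norm_num) (by norm_num) (ofReal_mul_I_im_ne_zero hy.ne') =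
      eta (-1) 3 (by norm_num) (by norm_num) (ofReal_mul_I_im_ne_zero hy.ne') *
        castQ (-1) 3 (ofStarCoords (-1) 3 ![m, 0, n]) := by
  have ht := sq_sub_three_mul_sq_pos_of_axis hy (m := (m : ℝ)) (n := (n : ℝ))
    (by rcases hmn with h | h
        · exact Or.inl (by exact_mod_cast h)
        · exact Or.inr (by exact_mod_cast h)) hrel
  have htQ : (m : ℚ) ^ 2 - 3 * (n : ℚ) ^ 2 ≠ 0 := by
    have : (0 : ℝ) < ((m : ℚ) ^ 2 - 3 * (n : ℚ) ^ 2 : ℚ) := by push_cast; exact ht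
    exact (by exact_mod_cast this : (0 : ℚ) < _).ne'
  refine (comm_eta_iff_moebius_eq (a := -1) (b := 3) (by norm_num) (by norm_num) (ofReal_mul_I_im_ne_zero hy.ne') _
    ?_).2 (moebius_rho_ofStarCoords_of_axis hy hmn hrel)
  rw [re_ofStarCoords_mul_star (by norm_num) (by norm_num), div_ne_zero_iff]
  refine ⟨?_, by norm_num⟩
  simp only [Matrix.cons_val_zero, Matrix.cons_val_one, Matrix.head_cons, Matrix.cons_val_two, Matrix.tail_cons]
  push_cast
  intro h
  apply htQ
  linear_combination h

/-- `p = (m, 0, n)` is primitive for coprime `(m, n)` (Bézout vector `(u, 0, v)`). [folklore] -/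
private theorem isPrimitive_of_isCoprime (h : IsCoprime m n) :
    ∃ w : Fin 3 → ℤ, ∑ k, w k * (![m, 0, n] : Fin 3 → ℤ) k = 1 := by
  obtain ⟨u, v, huv⟩ := h
  exact ⟨![u, 0, v], by simp [Fin.sum_univ_three, Matrix.cons_val_two]; linear_combination huv⟩

/-- A coprime pair is not `(0, 0)`. [folklore] -/
private theorem ne_zero_or_ne_zero_of_isCoprime (h : IsCoprime m n) : m ≠ 0 ∨ n ≠ 0 := by
  by_contra h0
  rw [not_or, not_not, not_not] at h0
  obtain ⟨rfl, rfl⟩ := h0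
  exact not_isCoprime_zero_zero h

end SpecialVector

/-! ## §3 The CM members over the axis are squares `(ℂ/(ℤ + ℤi√t))²` -/

section Squares

variable {m n : ℤ}

/-- **`C_{τ₂(t, 0, 1)} ≅ ℂ/(ℤ + ℤi√t)`**: `τ₂ = (0 + √(−4t))/2 = i√t`. [cite: ShiodaMitani1974, §3 (3.3)] -/
theorem isIsomorphic_ellipticPeriod_tau₂_diag {t : ℤ} (ht : 0 < t) (hΔ : (0 : ℤ) * 0 < 4 * t * 1) :
    IsIsomorphic (ellipticPeriod (ShiodaMitani.tau₂_im_pos hΔ).ne') (ellipticPeriod (sqrt_mul_I_im_ne_zero ht)) :=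
  isIsomorphic_ellipticPeriod_tau₂_sqrt (by ring) ⟨0, rfl⟩ ht _

/-- **`C_{τ₁(t, 0, 1)} ≅ ℂ/(ℤ + ℤi√t)`**: `τ₁ = (0 + √(−4t))/(2t) = i/√t = −1/(i√t)`, and `ℤ + ℤ(−1/τ) ≅ ℤ + ℤτ`
(unimodular data `(0 1; −1 0)`, multiplier `−i√t`). [cite: ShiodaMitani1974, §3 (3.3)–(3.5)] -/
theorem isIsomorphic_ellipticPeriod_tau₁_diag {t : ℤ} (ht : 0 < t) (hA₀ : (0 : ℤ) < t) (hΔ : (0 : ℤ) * 0 < 4 * t * 1) :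
    IsIsomorphic (ellipticPeriod (ShiodaMitani.tau₁_im_pos hA₀ hΔ).ne') (ellipticPeriod (sqrt_mul_I_im_ne_zero ht)) := by
  have ht0 : (t : ℂ) ≠ 0 := by exact_mod_cast ht.ne'
  have hst := sqrt_intCast_sq ht
  refine isIsomorphic_ellipticPeriod_of_eq _ _ (α := -((Real.sqrt t : ℂ) * I)) (a := 0) (b := 1) (c := -1) (d := 0)
    (Or.inl (by norm_num)) ?_ (by push_cast; ring)
  rw [ShiodaMitani.tau₁_eq_of_det (A := t) (B' := 0) (C := 1) (t := t) ht.ne' (by ring)]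
  push_cast
  rw [neg_zero, zero_div, zero_add, zero_mul, zero_add, ← mul_div_assoc, div_eq_iff ht0, one_mul]
  linear_combination (-((Real.sqrt t : ℝ) : ℂ) ^ 2) * Complex.I_sq + hst

/-- **HEADLINE. The CM members over the axis are squares: for `y > 0` and coprime `(m, n)` with
`m(1 − y²) = n√3(1 + y²)`, `t := m² − 3n² > 0` and `A(iy) ≅ ℂ/(ℤ + ℤi√t) × ℂ/(ℤ + ℤi√t)`.** Bézout data
`(g, q₀, q₂, u, v) = (1, m, n, u, v)`, `(A, B, C) = (t, 0, 1)` (the `j`-coordinate `p₂ = 0` kills `B` and the extra terms of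
`C`), so g28-#1/#2 give `A(iy) ≅ C_{τ₁(t,0,1)} × C_{τ₂(t,0,1)} = C_{i/√t} × C_{i√t}`, both `≅ ℂ/(ℤ + ℤi√t)`: the square of
the curve with complex multiplication by `ℤ[√−t]` («`Z(t)` … complex multiplication by the order `ℤ[√−t]`»).
[cite: ShiodaMitani1974, §3 (3.3)–(3.5), Thm. 3.2 and §4 Thm. 4.1 (iii)] [cite: KudlaRapoportYang2006, Ch. 1 p. 9 and §3.4 (3.4.7)–(3.4.9)] -/
theorem exists_isIsomorphic_prod_sqrt_of_axis {y : ℝ} (hy : 0 < y) (hmn : IsCoprime m n)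
    (hrel : (m : ℝ) * (1 - y ^ 2) = Real.sqrt 3 * n * (1 + y ^ 2)) :
    ∃ ht : 0 < m ^ 2 - 3 * n ^ 2,
      IsIsomorphic (period (-1) 3 (by norm_num) (by norm_num) (ofReal_mul_I_im_ne_zero hy.ne'))
        (prodPeriod (ellipticPeriod (sqrt_mul_I_im_ne_zero ht)) (ellipticPeriod (sqrt_mul_I_im_ne_zero ht))) := by
  have hmn0 := ne_zero_or_ne_zero_of_isCoprime hmn
  have htR := sq_sub_three_mul_sq_pos_of_axis hy (m := (m : ℝ)) (n := (n : ℝ))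
    (by rcases hmn0 with h | h
        · exact Or.inl (by exact_mod_cast h)
        · exact Or.inr (by exact_mod_cast h)) hrel
  have ht : 0 < m ^ 2 - 3 * n ^ 2 := by exact_mod_cast htR
  refine ⟨ht, ?_⟩
  obtain ⟨u, v, huv⟩ := hmn
  obtain ⟨B', hB', hA₀, hΔ, hiso, -⟩ := exists_isIsomorphic_prod_isogenous_cm_of_bezout (a := -1) (b := 3)
    (by norm_num) (by norm_num) (ofReal_mul_I_im_ne_zero hy.ne') (p := ![m, 0, n])
    (comm_eta_ofStarCoords_of_axis hy hmn0 hrel) (isPrimitive_of_isCoprime ⟨u, v, huv⟩) (g := 1) (u := u) (v := v)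
    (q₀ := m) (q₂ := n) (by simp) (by simp [Matrix.cons_val_two]) (by linear_combination huv)
    (A := m ^ 2 - 3 * n ^ 2) (B := 0) (C := 1) (by simp) (by simp) (by simp)
    (by show 0 < -((-1 : ℤ) * m ^ 2) - 3 * 0 ^ 2 + (-1) * 3 * n ^ 2; linarith)
  have hB0 : B' = 0 := by
    rcases hB' with h | h
    · exact h
    · rw [h, neg_zero]
  subst hB0
  exact hiso.trans ((isIsomorphic_ellipticPeriod_tau₁_diag ht hA₀ hΔ).prod (isIsomorphic_ellipticPeriod_tau₂_diag ht hΔ))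

/-- **`A(iy) ≅ (ℂ/(ℤ + ℤi√t))²`** (power form). [cite: ShiodaMitani1974, §4 Thm. 4.1 (iii)] [cite: KudlaRapoportYang2006, Ch. 1 p. 9] -/
theorem isIsomorphic_powPeriod_sqrt_of_axis {y : ℝ} (hy : 0 < y) (hmn : IsCoprime m n)
    (hrel : (m : ℝ) * (1 - y ^ 2) = Real.sqrt 3 * n * (1 + y ^ 2)) :
    ∃ ht : 0 < m ^ 2 - 3 * n ^ 2,
      IsIsomorphic (period (-1) 3 (by norm_num) (by norm_num) (ofReal_mul_I_im_ne_zero hy.ne'))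
        (powPeriod (ellipticPeriod (sqrt_mul_I_im_ne_zero ht)) 2) := by
  obtain ⟨ht, h⟩ := exists_isIsomorphic_prod_sqrt_of_axis hy hmn hrel
  exact ⟨ht, h.trans (isIsomorphic_powPeriod_two_prodPeriod _).symm⟩

/-- **`ρ(A(iy)) = 4`** at every CM point of the axis. [cite: ShiodaMitani1974, §3 (singular abelian surfaces)] [cite: KudlaRapoportYang2006, Ch. 1 p. 9] -/
theorem finrank_neronSeveriGroup_eq_four_of_axis {y : ℝ} (hy : 0 < y) (hmn : IsCoprime m n)
    (hrel : (m : ℝ) * (1 - y ^ 2) = Real.sqrt 3 * n * (1 + y ^ 2)) :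
    finrank ℤ (neronSeveriGroup (period (-1) 3 (by norm_num) (by norm_num) (ofReal_mul_I_im_ne_zero hy.ne'))) = 4 := by
  obtain ⟨ht, h⟩ := exists_isIsomorphic_prod_sqrt_of_axis hy hmn hrel
  exact (finrank_eq_four_iff_exists_isIsomorphic_prod (a := -1) (b := 3) (by norm_num) (by norm_num)
    (ofReal_mul_I_im_ne_zero hy.ne') forall_isUnit_neg_one_three').2 ⟨_, _, _, _, h⟩

/-- **`w(A(iy), ι) = 2` off `Z(1)`**: for `t = m² − 3n² ≠ 1` the CM point `iy` is not an elliptic point (g27-#1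
`natCard_units_of_ne_neg_one`; for `t = 1` it is one, g28-#5). [cite: KudlaRapoportYang2006, §3.4 (3.4.6) («`w(c²d)` is the number of units») and §3.2 Prop. 3.2.1] -/
theorem natCard_units_eq_two_of_axis {y : ℝ} (hy : 0 < y) (hmn : IsCoprime m n)
    (hrel : (m : ℝ) * (1 - y ^ 2) = Real.sqrt 3 * n * (1 + y ^ 2)) (ht1 : m ^ 2 - 3 * n ^ 2 ≠ 1) :
    Nat.card (equivariantEndRingInt (a := -1) (b := 3) (by norm_num) (by norm_num)
      (ofReal_mul_I_im_ne_zero hy.ne'))ˣ = 2 :=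
  natCard_units_of_ne_neg_one (a := -1) (b := 3) (by norm_num) (by norm_num) (ofReal_mul_I_im_ne_zero hy.ne')
    (p := ![m, 0, n]) (comm_eta_ofStarCoords_of_axis hy (ne_zero_or_ne_zero_of_isCoprime hmn) hrel)
    (isPrimitive_of_isCoprime hmn)
    (by show (-1 : ℤ) * m ^ 2 + 3 * 0 ^ 2 - (-1) * 3 * n ^ 2 ≠ -1; intro h; apply ht1; linarith)

end Squares

/-! ## §4 Every CM member over the axis is a square -/

section Converse

/-- **EVERY CM MEMBER OVER THE AXIS IS A SQUARE `(ℂ/(ℤ + ℤi√t))²`**: if `A(iy)` (`y > 0`) is not simple, there is a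
coprime pair `(m, n)` with `m(1 − y²) = n√3(1 + y²)` (g28-#4 `not_isSimple_iff_of_re_eq_zero`, normalised by §1), and
then `A(iy) ≅ (ℂ/(ℤ + ℤi√t))²`, `t = m² − 3n² > 0`. [cite: ShiodaMitani1974, §4 Thm. 4.1 (iii)] [cite: KudlaRapoportYang2006, §3.4 (3.4.8)–(3.4.9) and Prop. 3.4.5] [cite: Lang1982AbelianFunctions, Ch. IX §5 Thm. 5.1] -/
theorem exists_isIsomorphic_powPeriod_of_not_isSimple_axis {y : ℝ} (hy : 0 < y)
    (h : ¬ IsSimple (period (-1) 3 (by norm_num) (by norm_num) (ofReal_mul_I_im_ne_zero hy.ne'))) :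
    ∃ m n : ℤ, IsCoprime m n ∧ (m : ℝ) * (1 - y ^ 2) = Real.sqrt 3 * n * (1 + y ^ 2) ∧
      ∃ ht : 0 < m ^ 2 - 3 * n ^ 2,
        IsIsomorphic (period (-1) 3 (by norm_num) (by norm_num) (ofReal_mul_I_im_ne_zero hy.ne'))
          (powPeriod (ellipticPeriod (sqrt_mul_I_im_ne_zero ht)) 2) := by
  obtain ⟨m, n, hmn, hrel⟩ := (not_isSimple_iff_of_re_eq_zero (ofReal_mul_I_im_ne_zero hy.ne') (by simp)).1 h
  have hrel' : (m : ℝ) * (1 - y ^ 2) = Real.sqrt 3 * n * (1 + y ^ 2) := by simpa using hrel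
  obtain ⟨M, N, hMN, hREL⟩ := exists_isCoprime_of_axis hmn hrel'
  exact ⟨M, N, hMN, hREL, isIsomorphic_powPeriod_sqrt_of_axis hy hMN hREL⟩

/-- **`A(iy)` is NOT simple iff it is the square of some `ℂ/(ℤ + ℤi√t)`, `t = m² − 3n² > 0` a norm of a primitive
element of `ℤ[√3]` whose special vector fixes `iy`.** [cite: ShiodaMitani1974, §4 Thm. 4.1 (iii)] [cite: KudlaRapoportYang2006, Ch. 1 p. 9 and §3.4 (3.4.8)–(3.4.9)] -/
theorem not_isSimple_axis_iff_exists_sq {y : ℝ} (hy : 0 < y) :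
    ¬ IsSimple (period (-1) 3 (by norm_num) (by norm_num) (ofReal_mul_I_im_ne_zero hy.ne')) ↔
      ∃ m n : ℤ, IsCoprime m n ∧ (m : ℝ) * (1 - y ^ 2) = Real.sqrt 3 * n * (1 + y ^ 2) ∧
        ∃ ht : 0 < m ^ 2 - 3 * n ^ 2,
          IsIsomorphic (period (-1) 3 (by norm_num) (by norm_num) (ofReal_mul_I_im_ne_zero hy.ne'))
            (powPeriod (ellipticPeriod (sqrt_mul_I_im_ne_zero ht)) 2) := by
  refine ⟨exists_isIsomorphic_powPeriod_of_not_isSimple_axis hy, ?_⟩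
  rintro ⟨m, n, -, -, ht, h⟩
  exact not_isSimple_of_isIsogenous_powPeriod_two h.isIsogenous

end Converse

/-! ## §5 The `Z(6)`-point `i√(2 − √3) = i(√6 − √2)/2` -/

section Example

/-- `0 < √(2 − √3)`. [cite: KudlaRapoportYang2006, §3.4 (3.4.9) («`D_x`»)] -/
theorem sqrt_two_sub_sqrt_three_pos : 0 < Real.sqrt (2 - Real.sqrt 3) :=
  Real.sqrt_pos.2 (by have := sqrt_three_lt_two'; linarith)

/-- **The axis relation at `y = √(2 − √3)` with `(m, n) = (3, 1)`**: `3(1 − y²) = 3(√3 − 1) = √3(3 − √3) = √3(1 + y²)` —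
so `x = 3i + ij ∈ L(6)` (`Q(x) = 9 − 3 = 6`) fixes `i√(2 − √3)` (`= i(√6 − √2)/2`, `= i(3 − √3)/√6`).
[cite: KudlaRapoportYang2006, §3.4 (3.4.7)–(3.4.9)] -/
theorem axis_relation_sqrt_two_sub_sqrt_three :
    ((3 : ℤ) : ℝ) * (1 - Real.sqrt (2 - Real.sqrt 3) ^ 2) =
      Real.sqrt 3 * ((1 : ℤ) : ℝ) * (1 + Real.sqrt (2 - Real.sqrt 3) ^ 2) := by
  have hs := sqrt_three_mul_self''
  have h2 : Real.sqrt (2 - Real.sqrt 3) ^ 2 = 2 - Real.sqrt 3 :=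
    Real.sq_sqrt (by have := sqrt_three_lt_two'; linarith)
  rw [h2]
  push_cast
  linear_combination hs

/-- **`A(i√(2 − √3)) ≅ ℂ/(ℤ + ℤi√6) × ℂ/(ℤ + ℤi√6) = (ℂ/ℤ[√−6])²`**: the `Z(6)`-point of the axis is the square of the
elliptic curve with complex multiplication by `ℤ[√−6]` (class number `2`: NOT isomorphic to its Galois-conjugate curve
`ℂ/(2ℤ + ℤi√6)·`, but the fibre is still a square). [cite: ShiodaMitani1974, §4 Thm. 4.1 (iii)] [cite: KudlaRapoportYang2006, Ch. 1 p. 9 («complex multiplication by the order `ℤ[√−t]`»)] -/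
theorem isIsomorphic_sqrt_two_sub_sqrt_three_prod :
    IsIsomorphic (period (-1) 3 (by norm_num) (by norm_num) (ofReal_mul_I_im_ne_zero sqrt_two_sub_sqrt_three_pos.ne'))
      (prodPeriod (ellipticPeriod (sqrt_mul_I_im_ne_zero (t := 6) (by norm_num)))
        (ellipticPeriod (sqrt_mul_I_im_ne_zero (t := 6) (by norm_num)))) := by
  obtain ⟨ht, h⟩ := exists_isIsomorphic_prod_sqrt_of_axis sqrt_two_sub_sqrt_three_pos (m := 3) (n := 1)
    isCoprime_one_right axis_relation_sqrt_two_sub_sqrt_three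
  exact isIsomorphic_prod_sqrt_congr ht (by norm_num) (by norm_num) h

/-- **`ρ(A(i√(2 − √3))) = 4` and `w(A(i√(2 − √3)), ι) = 2`** (`t = 6 ≠ 1`: a CM point of the axis which is not an
elliptic point). [cite: KudlaRapoportYang2006, §3.4 (3.4.6) and §3.2 Prop. 3.2.1] [cite: ShiodaMitani1974, §3] -/
theorem finrank_and_natCard_units_sqrt_two_sub_sqrt_three :
    finrank ℤ (neronSeveriGroup (period (-1) 3 (by norm_num) (by norm_num)
        (ofReal_mul_I_im_ne_zero sqrt_two_sub_sqrt_three_pos.ne'))) = 4 ∧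
      Nat.card (equivariantEndRingInt (a := -1) (b := 3) (by norm_num) (by norm_num)
        (ofReal_mul_I_im_ne_zero sqrt_two_sub_sqrt_three_pos.ne'))ˣ = 2 :=
  ⟨finrank_neronSeveriGroup_eq_four_of_axis sqrt_two_sub_sqrt_three_pos (m := 3) (n := 1) isCoprime_one_right
      axis_relation_sqrt_two_sub_sqrt_three,
    natCard_units_eq_two_of_axis sqrt_two_sub_sqrt_three_pos (m := 3) (n := 1) isCoprime_one_right
      axis_relation_sqrt_two_sub_sqrt_three (by norm_num)⟩

end Example

end Literature.Geometry.Kaehler.ComplexTorus.QuaternionType
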